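import Summits.MatrixMultiplication.MatrixMultiplication.Theorems.SoloBlindPairQuotient

/-!
# The ladder law: iterating the pair move (all ranks, all lengths)

Sub-programme (K₃) (Kraft inequality for zero-sum-free sequences over `𝔽₃`), H-good half.
Setting: an abelian group `G` of exponent `3`, `h : ι → G` zero-sum free on `S`, `τ` H-good on `S`,
`N_k = N_k(τ; S)` the number of `k`-subsets of `S` with `h`-sum `τ`.

The pair move of `SoloBlindPairQuotient` (pass to `G ⧸ ℤ(h y - h x)` for a pair representation `{x, y}`,
delete `x, y`) reproduces all hypotheses one size down: `N_{k+1}(τ; S) ≤ N'_k` for `k ≥ 2`, the image target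
again H-good, the image sequence again zero-sum free.  Iterating it along a chain `N_2, N_3, … ≥ 1` gives,
by induction over the chain length with the GROUP VARYING (the statements below quantify over all
exponent-`3` groups in a fixed universe):

* `soloBlind_ladder`: if `N_j ≥ 1` for all `2 ≤ j ≤ m + 2`, then `N_{m+4} + 2 N_{m+3} ≤ 4`
  (the window `(E≤4)` of the `(m+1)`-fold quotient);
* `soloBlind_ladder_kill`: if `N_j ≥ 1` for `2 ≤ j ≤ i + 1` and `N_{i+2} ≥ 2`, then `N_j = 0` for all
  `j ≥ i + 3` (two pairs in the `i`-fold quotient kill everything larger);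
* `soloBlind_ladder_profile`: under the same hypotheses the whole profile is forced:
  `N_1 = 0`, `N_j = 1` for `2 ≤ j ≤ i + 1`, `N_{i+2} = 2`, `N_j = 0` for `j ≥ i + 3` — so the Kraft mass
  `∑_j N_j 2^{-j}` is EXACTLY `1/2`: Conjecture E (mass `≤ 1/2` for H-good targets) holds with equality on
  this "doubly-ended binary stratum", in every rank.
Consequently Conjecture E reduces to the PAIR-FREE stratum (`N_1 = N_2 = 0`) of the iterated quotients.
-/

namespace Summit.MatrixMultiplication.MatrixMultiplication.Theorems

open Finset

universe u

variable {ι : Type*} [DecidableEq ι]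

omit [DecidableEq ι] in
/-- A quotient of a group of exponent `3` has exponent `3`. -/
theorem soloBlind_quot_three {G : Type u} [AddCommGroup G] (three : ∀ g : G, g + g + g = 0)
    (H : AddSubgroup G) : ∀ g' : G ⧸ H, g' + g' + g' = 0 := by
  intro g'
  obtain ⟨z, rfl⟩ := QuotientAddGroup.mk_surjective g'
  have e : (QuotientAddGroup.mk z : G ⧸ H) = QuotientAddGroup.mk' H z := rfl
  rw [e, ← map_add, ← map_add, three, map_zero]

omit [DecidableEq ι] in
/-- The kernel of `G → G ⧸ ℤd` in exponent `3` is `{0, d, d + d}`. -/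
theorem soloBlind_quot_ker {G : Type u} [AddCommGroup G] (three : ∀ g : G, g + g + g = 0) (d : G) :
    ∀ g : G, QuotientAddGroup.mk' (AddSubgroup.zmultiples d) g = 0 → g = 0 ∨ g = d ∨ g = d + d :=
  fun g hg => soloBlind_zmultiples_cases three d ((QuotientAddGroup.eq_zero_iff g).mp hg)

omit [DecidableEq ι] in
/-- `a` and `b` have the same image in `G ⧸ ℤ(b - a)`. -/
theorem soloBlind_quot_pair {G : Type u} [AddCommGroup G] (a b : G) :
    QuotientAddGroup.mk' (AddSubgroup.zmultiples (b - a)) a =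
      QuotientAddGroup.mk' (AddSubgroup.zmultiples (b - a)) b := by
  rw [QuotientAddGroup.mk'_apply, QuotientAddGroup.mk'_apply, QuotientAddGroup.eq,
    AddSubgroup.mem_zmultiples_iff]
  exact ⟨1, by rw [one_zsmul]; abel⟩

/-- A pair representation is literally a pair `{x, y}` with `x ≠ y`. -/
theorem soloBlind_exists_pair_of_card_pos {G : Type u} [AddCommGroup G] [DecidableEq G] {h : ι → G}
    {S : Finset ι}
    {τ : G} (hpos : 1 ≤ (soloBlindSeqRep h S 2 τ).card) :
    ∃ x y : ι, x ≠ y ∧ ({x, y} : Finset ι) ∈ soloBlindSeqRep h S 2 τ := by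
  obtain ⟨P, hP⟩ := Finset.card_pos.mp hpos
  obtain ⟨-, hPc, -⟩ := soloBlind_mem_seqRep.mp hP
  obtain ⟨x, y, hxy, rfl⟩ := Finset.card_eq_two.mp hPc
  exact ⟨x, y, hxy, hP⟩

/-- THE LADDER LAW (all ranks, all chain lengths): for `h` zero-sum free on `S` in a group of exponent `3`
and `τ` H-good, if every layer `N_j`, `2 ≤ j ≤ m + 2`, is non-empty, then `N_{m+4} + 2 N_{m+3} ≤ 4`.
(`m = 0` is `soloBlind_window_four_of_pair`; the step is the pair move.) -/
theorem soloBlind_ladder (m : ℕ) :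
    ∀ {G : Type u} [AddCommGroup G] [DecidableEq G], (∀ g : G, g + g + g = 0) →
      ∀ (h : ι → G) (S : Finset ι), (∀ T ⊆ S, T.Nonempty → ∑ i ∈ T, h i ≠ 0) →
      ∀ τ : G, (∀ T ⊆ S, ∑ i ∈ T, h i ≠ τ + τ) →
      (∀ j : ℕ, 2 ≤ j → j ≤ m + 2 → 1 ≤ (soloBlindSeqRep h S j τ).card) →
      (soloBlindSeqRep h S (m + 4) τ).card + 2 * (soloBlindSeqRep h S (m + 3) τ).card ≤ 4 := by
  induction m with
  | zero =>
      intro G _ _ three h S zsf τ hgood hlad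
      have h2 : 1 ≤ (soloBlindSeqRep h S 2 τ).card := hlad 2 le_rfl (by norm_num)
      obtain ⟨x, y, -, hP⟩ := soloBlind_exists_pair_of_card_pos h2
      have W := soloBlind_window_four_of_pair three h S zsf τ hgood hP
      simp only [Nat.zero_add]
      omega
  | succ m ih =>
      intro G _ _ three h S zsf τ hgood hlad
      classical
      have h2 : 1 ≤ (soloBlindSeqRep h S 2 τ).card := hlad 2 le_rfl (by omega)
      obtain ⟨x, y, -, hP⟩ := soloBlind_exists_pair_of_card_pos h2
      have hker := soloBlind_quot_ker three (h y - h x)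
      have hπ := soloBlind_quot_pair (h x) (h y)
      have three' := soloBlind_quot_three three (AddSubgroup.zmultiples (h y - h x))
      have zsf' := soloBlind_move_zsf three zsf hgood hP _ hker
      have hgood' := soloBlind_move_hgood three zsf hgood hP _ hker
      have hlad' : ∀ j : ℕ, 2 ≤ j → j ≤ m + 2 →
          1 ≤ (soloBlindSeqRep (fun i => QuotientAddGroup.mk' (AddSubgroup.zmultiples (h y - h x)) (h i))
            (S \ {x, y}) j (QuotientAddGroup.mk' (AddSubgroup.zmultiples (h y - h x)) (h x))).card := by
        intro j hj hjm
        have t := soloBlind_move_card_le three zsf hgood hP _ hπ (k := j) hj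
        have := hlad (j + 1) (by omega) (by omega)
        omega
      have key := ih three' _ (S \ {x, y}) zsf' _ hgood' hlad'
      have t1 : (soloBlindSeqRep h S (m + 1 + 4) τ).card ≤
          (soloBlindSeqRep (fun i => QuotientAddGroup.mk' (AddSubgroup.zmultiples (h y - h x)) (h i))
            (S \ {x, y}) (m + 4) (QuotientAddGroup.mk' (AddSubgroup.zmultiples (h y - h x)) (h x))).card :=
        soloBlind_move_card_le three zsf hgood hP _ hπ (k := m + 4) (by omega)
      have t2 : (soloBlindSeqRep h S (m + 1 + 3) τ).card ≤
          (soloBlindSeqRep (fun i => QuotientAddGroup.mk' (AddSubgroup.zmultiples (h y - h x)) (h i))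
            (S \ {x, y}) (m + 3) (QuotientAddGroup.mk' (AddSubgroup.zmultiples (h y - h x)) (h x))).card :=
        soloBlind_move_card_le three zsf hgood hP _ hπ (k := m + 3) (by omega)
      omega

/-- THE KILL LAW (all ranks): if `N_j ≥ 1` for `2 ≤ j ≤ i + 1` and `N_{i+2} ≥ 2`, then `N_j = 0` for every
`j ≥ i + 3` (two pair representations in the `i`-fold quotient, `soloBlind_hgood_two_pairs_layers`). -/
theorem soloBlind_ladder_kill (i : ℕ) :
    ∀ {G : Type u} [AddCommGroup G] [DecidableEq G], (∀ g : G, g + g + g = 0) →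
      ∀ (h : ι → G) (S : Finset ι), (∀ T ⊆ S, T.Nonempty → ∑ i ∈ T, h i ≠ 0) →
      ∀ τ : G, (∀ T ⊆ S, ∑ i ∈ T, h i ≠ τ + τ) →
      (∀ j : ℕ, 2 ≤ j → j ≤ i + 1 → 1 ≤ (soloBlindSeqRep h S j τ).card) →
      2 ≤ (soloBlindSeqRep h S (i + 2) τ).card →
      ∀ j : ℕ, i + 3 ≤ j → (soloBlindSeqRep h S j τ).card = 0 := by
  induction i with
  | zero =>
      intro G _ _ three h S zsf τ hgood _ htwo j hj
      simp only [Nat.zero_add] at htwo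
      obtain ⟨-, -, hz⟩ := soloBlind_hgood_two_pairs_layers three h S zsf τ hgood htwo
      obtain ⟨j', rfl⟩ : ∃ j', j = j' + 1 := ⟨j - 1, by omega⟩
      exact hz j' (by omega)
  | succ i ih =>
      intro G _ _ three h S zsf τ hgood hlad htwo j hj
      classical
      have h2 : 1 ≤ (soloBlindSeqRep h S 2 τ).card := hlad 2 le_rfl (by omega)
      obtain ⟨x, y, -, hP⟩ := soloBlind_exists_pair_of_card_pos h2
      have hker := soloBlind_quot_ker three (h y - h x)
      have hπ := soloBlind_quot_pair (h x) (h y)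
      have three' := soloBlind_quot_three three (AddSubgroup.zmultiples (h y - h x))
      have zsf' := soloBlind_move_zsf three zsf hgood hP _ hker
      have hgood' := soloBlind_move_hgood three zsf hgood hP _ hker
      have hlad' : ∀ j : ℕ, 2 ≤ j → j ≤ i + 1 →
          1 ≤ (soloBlindSeqRep (fun i => QuotientAddGroup.mk' (AddSubgroup.zmultiples (h y - h x)) (h i))
            (S \ {x, y}) j (QuotientAddGroup.mk' (AddSubgroup.zmultiples (h y - h x)) (h x))).card := by
        intro j hj hjm
        have t := soloBlind_move_card_le three zsf hgood hP _ hπ (k := j) hj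
        have := hlad (j + 1) (by omega) (by omega)
        omega
      have htwo' : 2 ≤ (soloBlindSeqRep
          (fun i => QuotientAddGroup.mk' (AddSubgroup.zmultiples (h y - h x)) (h i))
            (S \ {x, y}) (i + 2) (QuotientAddGroup.mk' (AddSubgroup.zmultiples (h y - h x)) (h x))).card := by
        have t : (soloBlindSeqRep h S (i + 1 + 2) τ).card ≤
            (soloBlindSeqRep (fun i => QuotientAddGroup.mk' (AddSubgroup.zmultiples (h y - h x)) (h i))
              (S \ {x, y}) (i + 2) (QuotientAddGroup.mk' (AddSubgroup.zmultiples (h y - h x)) (h x))).card :=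
          soloBlind_move_card_le three zsf hgood hP _ hπ (k := i + 2) (by omega)
        omega
      obtain ⟨j', rfl⟩ : ∃ j', j = j' + 1 := ⟨j - 1, by omega⟩
      have key := ih three' _ (S \ {x, y}) zsf' _ hgood' hlad' htwo' j' (by omega)
      have t := soloBlind_move_card_le three zsf hgood hP _ hπ (k := j') (by omega)
      omega

/-- THE FORCED PROFILE (Conjecture E with equality on the doubly-ended binary stratum, all ranks): if `N_j ≥ 1`
for `2 ≤ j ≤ i + 1` and `N_{i+2} ≥ 2`, then `N_1 = 0`, `N_j = 1` for `2 ≤ j ≤ i + 1`, `N_{i+2} = 2` and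
`N_j = 0` for `j ≥ i + 3`; the Kraft mass `∑_j N_j 2^{-j} = ∑_{j=2}^{i+1} 2^{-j} + 2·2^{-(i+2)}` equals
`1/2` exactly. -/
theorem soloBlind_ladder_profile {G : Type u} [AddCommGroup G] [DecidableEq G]
    (three : ∀ g : G, g + g + g = 0) (h : ι → G) (S : Finset ι)
    (zsf : ∀ T ⊆ S, T.Nonempty → ∑ i ∈ T, h i ≠ 0) (τ : G)
    (hgood : ∀ T ⊆ S, ∑ i ∈ T, h i ≠ τ + τ) (i : ℕ)
    (hlad : ∀ j : ℕ, 2 ≤ j → j ≤ i + 1 → 1 ≤ (soloBlindSeqRep h S j τ).card)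
    (htwo : 2 ≤ (soloBlindSeqRep h S (i + 2) τ).card) :
    (soloBlindSeqRep h S 1 τ).card = 0 ∧
      (∀ j : ℕ, 2 ≤ j → j ≤ i + 1 → (soloBlindSeqRep h S j τ).card = 1) ∧
      (soloBlindSeqRep h S (i + 2) τ).card = 2 ∧
      (∀ j : ℕ, i + 3 ≤ j → (soloBlindSeqRep h S j τ).card = 0) := by
  have hkill := soloBlind_ladder_kill i three h S zsf τ hgood hlad htwo
  -- N_1 = 0: either two pairs (i = 0) or a pair with a value would kill the pair
  have hW3 := soloBlind_window_three three h S zsf τ hgood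
  have hN1 : (soloBlindSeqRep h S 1 τ).card = 0 := by
    rcases Nat.eq_zero_or_pos i with rfl | hi
    · simp only [Nat.zero_add] at htwo
      omega
    · have := hlad 2 le_rfl (by omega)
      omega
  refine ⟨hN1, ?_, ?_, hkill⟩
  · intro j hj hji
    -- lower bound from hlad, upper bound from the ladder law at level j - 2 … needs N_{j+1} ≥ 1
    have hlow := hlad j hj hji
    rcases Nat.lt_or_ge j 3 with hj3 | hj3
    · -- j = 2: window three with N_3 ≥ 1 (if i ≥ 2) or N_{i+2} = N_3 ≥ 2 (if i = 1)
      have hj2 : j = 2 := by omega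
      subst hj2
      have h3 : 1 ≤ (soloBlindSeqRep h S 3 τ).card := by
        rcases Nat.lt_or_ge i 2 with hi | hi
        · have hi1 : i = 1 := by omega
          subst hi1
          simp only [Nat.reduceAdd] at htwo
          omega
        · exact hlad 3 (by norm_num) (by omega)
      omega
    · -- j ≥ 3: ladder law with m = j - 3 gives N_{j+1} + 2 N_j ≤ 4, and N_{j+1} ≥ 1
      have L := soloBlind_ladder (j - 3) three h S zsf τ hgood
        (fun j' hj' hj'm => hlad j' hj' (by omega))
      rw [show j - 3 + 4 = j + 1 from by omega, show j - 3 + 3 = j from by omega] at L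
      have hnext : 1 ≤ (soloBlindSeqRep h S (j + 1) τ).card := by
        rcases Nat.lt_or_ge (j + 1) (i + 2) with hlt | hge
        · exact hlad (j + 1) (by omega) (by omega)
        · have e : j + 1 = i + 2 := by omega
          rw [e]; omega
      omega
  · -- N_{i+2} ≤ 2: window three (i = 0) or the ladder law at m = i - 1
    rcases Nat.eq_zero_or_pos i with rfl | hi
    · simp only [Nat.zero_add] at htwo ⊢
      omega
    · have L := soloBlind_ladder (i - 1) three h S zsf τ hgood
        (fun j' hj' hj'm => hlad j' hj' (by omega))
      rw [show i - 1 + 4 = i + 3 from by omega, show i - 1 + 3 = i + 2 from by omega] at L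
      omega

end Summit.MatrixMultiplication.MatrixMultiplication.Theorems
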